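import Mathlib.Analysis.SpecialFunctions.Log.Base
import Mathlib.Analysis.SpecialFunctions.Pow.Real
import Mathlib.Analysis.SpecialFunctions.Sqrt
import HarnessLib

/-!
# Binary polarization trees: leaves and Arıkan's one-step relations (definitions)

Topic `Literature/InformationTheory/Coding` (crux `PeaTwoMemBPP` of route PneNP/SzkEntropy, line
`polarize-to-one-bit-leakage`; the rough/fine polarization theorems over this vocabulary are the files
`PolarizationTreeRough.lean` / `PolarizationTreeFine.lean`).  The abstract setting of polarization [Arıkan 2009, §VII;
Arıkan 2010, §III]: a type `𝒮` of "channels/sources" with two transforms `minus, plus : 𝒮 → 𝒮`;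
`leaf minus plus s h j` is the `j`-th node at depth `s` below `h`, reading the bits of `j` from the
top (bit `0` = `minus`, bit `1` = `plus`; natural index order = bit-reversed Arıkan order); and the
structure `StepBounds 𝒮` recording a `[0,1]`-valued entropy `H` and Bhattacharyya parameter `Z`
obeying Arıkan's one-step relations `H⁻ + H⁺ = 2H`, `Z⁺ = Z²`, `Z√(2−Z²) ≤ Z⁻ ≤ 2Z − Z²`,
`Z² ≤ H ≤ log₂(1+Z)` [Arıkan 2009, Prop. 5, 7; Arıkan 2010, Prop. 1–2; Korada–Urbanke 2010,
Lemma 17].  Binary sources with functional side information carry this structure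
(`Literature/InformationTheory/Coding/SourcePolarizationTree.lean`, `Src.stepBounds`).

## References

* E. Arıkan, *Channel polarization…*, IEEE Trans. IT 55 (2009), §VII, Prop. 5, Prop. 7.  bib `Arikan2009`.
* E. Arıkan, *Source polarization*, Proc. IEEE ISIT 2010, §III, Prop. 1–2.  bib `Arikan2010`.
* S. B. Korada, R. Urbanke, IEEE Trans. IT 56 (2010), Lemma 17.  bib `KoradaUrbanke2010`.
-/

namespace Literature.InformationTheory.Coding.PolarTree

universe u

/-- Leaf `j` of the depth-`s` polarization tree over `h`: read the bits of `j` from the TOP; bit `0`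
= `minus`, bit `1` = `plus`, applied in that order (`leaf (s+1) h j = leaf s (minus h) j` for
`j < 2^s`, `= leaf s (plus h) (j - 2^s)` otherwise).
[cite: Arikan2009, §VII (recursive channel transformations, natural order = bit-reversed Arıkan order)] -/
def leaf {𝒮 : Type u} (minus plus : 𝒮 → 𝒮) : (s : ℕ) → 𝒮 → Fin (2 ^ s) → 𝒮
  | 0, h, _ => h
  | s + 1, h, j =>
    if hj : (j : ℕ) < 2 ^ s then leaf minus plus s (minus h) ⟨j, hj⟩
    else leaf minus plus s (plus h) ⟨(j : ℕ) - 2 ^ s, by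
      have h1 : (j : ℕ) < 2 ^ (s + 1) := j.isLt
      have h2 : 2 ^ (s + 1) = 2 ^ s + 2 ^ s := by rw [pow_succ]; ring
      omega⟩

/-- Arıkan's one-step relations for a `[0,1]`-valued "entropy" `H` and "Bhattacharyya parameter" `Z`
under the two transforms `minus`, `plus`.
[cite: Arikan2009, Prop. 5 and Prop. 7 (with Arikan2010 Prop. 1–2 and KoradaUrbanke2010 Lemma 17 for the lower bound on Z⁻)] -/
structure StepBounds (𝒮 : Type u) where
  /-- the minus transform -/
  minus : 𝒮 → 𝒮
  /-- the plus transform -/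
  plus : 𝒮 → 𝒮
  /-- the entropy functional -/
  H : 𝒮 → ℝ
  /-- the Bhattacharyya functional -/
  Z : 𝒮 → ℝ
  /-- `0 ≤ Z` -/
  Z_nonneg : ∀ h, 0 ≤ Z h
  /-- `Z ≤ 1` -/
  Z_le_one : ∀ h, Z h ≤ 1
  /-- `0 ≤ H` -/
  H_nonneg : ∀ h, 0 ≤ H h
  /-- `H ≤ 1` -/
  H_le_one : ∀ h, H h ≤ 1
  /-- conservation `H⁻ + H⁺ = 2H` -/
  H_step : ∀ h, H (minus h) + H (plus h) = 2 * H h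
  /-- `Z⁺ = Z²` -/
  Z_plus : ∀ h, Z (plus h) = Z h ^ 2
  /-- `Z⁻ ≤ 2Z − Z²` -/
  Z_minus_le : ∀ h, Z (minus h) ≤ 2 * Z h - Z h ^ 2
  /-- `Z√(2 − Z²) ≤ Z⁻` -/
  Z_minus_ge : ∀ h, Z h * Real.sqrt (2 - Z h ^ 2) ≤ Z (minus h)
  /-- `Z² ≤ H` -/
  sq_Z_le_H : ∀ h, Z h ^ 2 ≤ H h
  /-- `H ≤ log₂(1 + Z)` -/
  H_le_logb : ∀ h, H h ≤ Real.logb 2 (1 + Z h)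

/-- Depth zero: the only leaf is the root. [folklore] -/
@[simp] theorem leaf_zero {𝒮 : Type u} (minus plus : 𝒮 → 𝒮) (h : 𝒮) (j : Fin (2 ^ 0)) :
    leaf minus plus 0 h j = h :=
  rfl

/-- Low leaves of depth `s+1` are leaves of depth `s` below `minus h`. [folklore] -/
theorem leaf_succ_of_lt {𝒮 : Type u} (minus plus : 𝒮 → 𝒮) (s : ℕ) (h : 𝒮) (j : Fin (2 ^ (s + 1)))
    (hj : (j : ℕ) < 2 ^ s) : leaf minus plus (s + 1) h j = leaf minus plus s (minus h) ⟨j, hj⟩ := by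
  simp [leaf, hj]

/-- High leaves of depth `s+1` are leaves of depth `s` below `plus h`. [folklore] -/
theorem leaf_succ_of_ge {𝒮 : Type u} (minus plus : 𝒮 → 𝒮) (s : ℕ) (h : 𝒮) (j : Fin (2 ^ (s + 1)))
    (hj : 2 ^ s ≤ (j : ℕ)) (hj' : (j : ℕ) - 2 ^ s < 2 ^ s) :
    leaf minus plus (s + 1) h j = leaf minus plus s (plus h) ⟨(j : ℕ) - 2 ^ s, hj'⟩ := by
  simp [leaf, Nat.not_lt.2 hj]

end Literature.InformationTheory.Coding.PolarTree
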